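import Mathlib.Analysis.Convex.PathConnected
import Mathlib.Analysis.Convex.Contractible
import Mathlib.AlgebraicTopology.FundamentalGroupoid.SimplyConnected
import Mathlib.Topology.Homotopy.Path
import HarnessLib

/-!
# A twist along a transversal arc: `T ∘ α ≃ α · c`

Topic `Literature/AlgebraicTopology/FundamentalGroup`; a generic homotopy lemma written for the
Dehn–Nielsen–Baer seat (`Literature/Topology/FourManifolds/DehnNielsenBaerSurface.lean`, W2.3: the
action of the realised Dehn twists on the marking).  A Dehn twist `T` along an annulus is, on the
annulus, `x ↦ θ(λ(x), x)` for a flow `θ` and a profile `λ` rising from `0` to a full period; along an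
arc `α` crossing the annulus, `T ∘ α` is the arc "dragged around", and the two-parameter family
`F(u, t) = θ(u λ(t), α(t))` exhibits `T ∘ α` as homotopic to `α` followed by the closed orbit at the
exit point.  Here, in the generality of a continuous "flow-like" map `θ : ℝ × X → X` with
`θ(0, ·) = id`:

* `homotopic_map_of_square` — **the square lemma**: for `F : C(ℝ × ℝ, X)` the two edge paths of the
  unit square from `(0,0)` to `(1,1)` have homotopic images (the plane is simply connected);
* `TwistAlongArc.homotopic_twist_arc` — **`T ∘ α ≃ α · c` rel end points**, where
  `(T ∘ α)(t) = θ(λ t, α t)`, `λ 0 = 0`, and `c(u) = θ(u λ(1), α 1)` is a loop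
  (`θ(λ 1, α 1) = α 1`).

Everything is proved; no named facts (D-0026).

## References

* B. Farb, D. Margalit, *A primer on mapping class groups* (2012), §3.1.1 (the action of a Dehn
  twist on curves crossing its annulus), Prop. 3.2. [FarbMargalit2012]
* A. Hatcher, *Algebraic Topology* (2002), §1.1. [HatcherAT2002]
-/

open scoped unitInterval Topology
open Set Function

noncomputable section

namespace Literature.AlgebraicTopology.FundamentalGroup

variable {X : Type*} [TopologicalSpace X]

/-! ### §1 The square lemma -/

/-- **The square lemma**: for a continuous map `F` of the plane, the images of the two edge paths
`(0,0) → (1,0) → (1,1)` and `(0,0) → (0,1) → (1,1)` of the unit square are homotopic rel end points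
(the plane is simply connected). [cite: HatcherAT2002, §1.1] -/
theorem homotopic_map_of_square (F : C(ℝ × ℝ, X)) :
    (((Path.segment ((0 : ℝ), (0 : ℝ)) (1, 0)).trans (Path.segment ((1 : ℝ), (0 : ℝ)) (1, 1))).map
        F.continuous).Homotopic
      (((Path.segment ((0 : ℝ), (0 : ℝ)) (0, 1)).trans (Path.segment ((0 : ℝ), (1 : ℝ)) (1, 1))).map
        F.continuous) :=
  (SimplyConnectedSpace.paths_homotopic _ _).map F

/-! ### §2 The twist along a transversal arc -/

namespace TwistAlongArc

variable (θ : C(ℝ × X, X)) {a b : X} (α : Path a b) (lam : C(I, ℝ))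

/-- The two-parameter family `F(u, t) = θ(u λ(t), α(t))` on the plane (clamped to the square). [folklore] -/
def family : C(ℝ × ℝ, X) :=
  θ.comp ⟨fun p : ℝ × ℝ => ((projIcc 0 1 zero_le_one p.1 : ℝ) * lam (projIcc 0 1 zero_le_one p.2),
      α.extend p.2),
    ((continuous_subtype_val.comp (continuous_projIcc.comp continuous_fst)).mul
      (lam.continuous.comp (continuous_projIcc.comp continuous_snd))).prodMk
      (α.continuous_extend.comp continuous_snd)⟩

/-- `F`, evaluated. [folklore] -/
theorem family_apply (p : ℝ × ℝ) :
    family θ α lam p = θ (((projIcc 0 1 zero_le_one p.1 : ℝ) * lam (projIcc 0 1 zero_le_one p.2)),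
      α.extend p.2) := rfl

variable {θ α lam}

/-- The bottom edge of the family is constant when `θ(0, ·) = id` and `λ(0) = 0`. [folklore] -/
theorem family_bottom (hθ : ∀ x, θ (0, x) = x) (h0 : lam 0 = 0) (u : ℝ) : family θ α lam (u, 0) = a := by
  rw [family_apply]
  have h1 : projIcc (0 : ℝ) 1 zero_le_one (0 : ℝ) = 0 := Subtype.ext (by simp [projIcc])
  dsimp only
  rw [h1, h0, mul_zero, Path.extend_zero, hθ]

/-- **The closed orbit at the exit point**: `c(u) = θ(u λ(1), α(1))`, a loop when
`θ(λ 1, α 1) = α 1`. [folklore] -/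
def orbitLoop (hθ : ∀ x, θ (0, x) = x) (hper : θ (lam 1, b) = b) : Path b b where
  toFun u := θ ((u : ℝ) * lam 1, b)
  continuous_toFun := θ.continuous.comp ((continuous_subtype_val.mul continuous_const).prodMk continuous_const)
  source' := by simp [hθ]
  target' := by simp [hper]

/-- The orbit loop, evaluated. [folklore] -/
theorem orbitLoop_apply (hθ : ∀ x, θ (0, x) = x) (hper : θ (lam 1, b) = b) (u : I) :
    orbitLoop hθ hper u = θ ((u : ℝ) * lam 1, b) := rfl

variable (α) in
/-- **The twisted arc** `t ↦ θ(λ(t), α(t))`. [folklore] -/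
def twistArc (hθ : ∀ x, θ (0, x) = x) (h0 : lam 0 = 0) (hper : θ (lam 1, b) = b) : Path a b where
  toFun t := θ (lam t, α t)
  continuous_toFun := θ.continuous.comp (lam.continuous.prodMk α.continuous)
  source' := by simp [h0, hθ]
  target' := by simp [hper]

/-- The twisted arc, evaluated. [folklore] -/
theorem twistArc_apply (hθ : ∀ x, θ (0, x) = x) (h0 : lam 0 = 0) (hper : θ (lam 1, b) = b) (t : I) :
    twistArc α hθ h0 hper t = θ (lam t, α t) := rfl

/-- **`T ∘ α ≃ α · c` rel end points**: the twisted arc is homotopic to the arc followed by the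
closed orbit at its exit point. [cite: FarbMargalit2012, §3.1.1 and Prop. 3.2] -/
theorem homotopic_twistArc (hθ : ∀ x, θ (0, x) = x) (h0 : lam 0 = 0) (hper : θ (lam 1, b) = b) :
    (twistArc α hθ h0 hper).Homotopic (α.trans (orbitLoop hθ hper)) := by
  have hsq := homotopic_map_of_square (family θ α lam)
  -- identify the four edges
  have hbot : ((Path.segment ((0 : ℝ), (0 : ℝ)) (1, 0)).map (family θ α lam).continuous) =
      (Path.refl a).cast (family_bottom hθ h0 0) (family_bottom hθ h0 1) := by
    apply Path.ext
    funext u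
    rw [Path.map_coe, comp_apply, Path.cast_coe, Path.refl_apply, Path.segment_apply]
    have : AffineMap.lineMap ((0 : ℝ), (0 : ℝ)) ((1 : ℝ), (0 : ℝ)) (u : ℝ) = ((u : ℝ), 0) := by
      rw [AffineMap.lineMap_apply_module]; ext <;> simp
    rw [this, family_bottom hθ h0]
  have hright : ((Path.segment ((1 : ℝ), (0 : ℝ)) (1, 1)).map (family θ α lam).continuous) =
      (twistArc α hθ h0 hper).cast (family_bottom hθ h0 1)
        (by rw [family_apply]; simp [projIcc_right, hper]) := by
    apply Path.ext
    funext t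
    rw [Path.map_coe, comp_apply, Path.cast_coe, twistArc_apply, Path.segment_apply]
    have : AffineMap.lineMap ((1 : ℝ), (0 : ℝ)) ((1 : ℝ), (1 : ℝ)) (t : ℝ) = ((1 : ℝ), (t : ℝ)) := by
      rw [AffineMap.lineMap_apply_module]; ext <;> simp
    rw [this, family_apply]
    simp [projIcc_right, projIcc_val zero_le_one t]
  have hleft : ((Path.segment ((0 : ℝ), (0 : ℝ)) (0, 1)).map (family θ α lam).continuous) =
      α.cast (family_bottom hθ h0 0) (by rw [family_apply]; simp [projIcc_left, hθ]) := by
    apply Path.ext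
    funext t
    rw [Path.map_coe, comp_apply, Path.cast_coe, Path.segment_apply]
    have : AffineMap.lineMap ((0 : ℝ), (0 : ℝ)) ((0 : ℝ), (1 : ℝ)) (t : ℝ) = ((0 : ℝ), (t : ℝ)) := by
      rw [AffineMap.lineMap_apply_module]; ext <;> simp
    rw [this, family_apply]
    simp [projIcc_left, projIcc_val zero_le_one t, hθ]
  have htop : ((Path.segment ((0 : ℝ), (1 : ℝ)) (1, 1)).map (family θ α lam).continuous) =
      (orbitLoop hθ hper).cast (by rw [family_apply]; simp [projIcc_left, hθ])
        (by rw [family_apply]; simp [projIcc_right, hper]) := by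
    apply Path.ext
    funext u
    rw [Path.map_coe, comp_apply, Path.cast_coe, orbitLoop_apply, Path.segment_apply]
    have : AffineMap.lineMap ((0 : ℝ), (1 : ℝ)) ((1 : ℝ), (1 : ℝ)) (u : ℝ) = ((u : ℝ), (1 : ℝ)) := by
      rw [AffineMap.lineMap_apply_module]; ext <;> simp
    rw [this, family_apply]
    simp [projIcc_right, projIcc_val zero_le_one u]
  rw [Path.map_trans, Path.map_trans, hbot, hright, hleft, htop] at hsq
  -- remove the casts and the constant bottom edge
  have key : ∀ {a' a'' b' b'' : X} (ha' : a' = a) (ha'' : a'' = a) (hb' : b' = b) (hb'' : b'' = b),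
      (((Path.refl a).cast ha' ha'').trans ((twistArc α hθ h0 hper).cast ha'' hb'')).Homotopic
        ((α.cast ha' hb').trans ((orbitLoop hθ hper).cast hb' hb'')) →
      (twistArc α hθ h0 hper).Homotopic (α.trans (orbitLoop hθ hper)) := by
    rintro a' a'' b' b'' rfl rfl rfl rfl h
    simp only [Path.cast_rfl_rfl] at h
    exact (Path.Homotopic.refl_trans _).symm.trans h
  exact key _ _ _ _ hsq

end TwistAlongArc

end Literature.AlgebraicTopology.FundamentalGroup

end
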